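import Literature.NumberTheory.Sieve.TypeTwoBlock
import HarnessLib

/-!
# Prime powers with exponent `≥ 2` in the cube are few (Hinz 1988, §2 (2.4))

Topic `Literature/NumberTheory/Sieve`, sub-namespace `SmoothPrimePowers`. Hinz (2.4):
`∑_{α∈ℜ} χ(α)Λ(α) = ∑_{ω∈ℜ} χ(ω) log Nω + O(log^r y ∑_{N𝔭^m ≤ y, m ≥ 2} log N𝔭)`, "the last error
term is `≪ y^{1/2} (log y)^r`". We prove the counting version used to pass from `Λ`-weighted sums
to prime counts in the cube `A₀(M)`:

* `card_higherPrimePowers_le` — `#{𝔞 : N𝔞 ≤ X, Λ(𝔞) ≠ 0, 𝔞 not prime} ≤ #idealsLE(√X) · (log₂⌊X⌋ + 1)`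
  (such `𝔞 = 𝔭^j`, `j ≥ 2`, `N𝔭 ≤ √X`, `j ≤ log₂ N𝔞`);
* `card_cube_higherPrimePowers_le` — `#{α ∈ A₀(M) : Λ((α)) ≠ 0, (α) not prime}`
  `≤ C_g (1 + log M)^{r} · #idealsLE(√(M^d)) · (log₂⌊M^d⌋ + 1)` (`M ≥ 1`).

## References

* J. Hinz, Acta Arith. 51 (1988), §2 (2.4). [cite: Hinz1988, §2 (2.4)]
-/

noncomputable section

open Finset NumberField UniqueFactorizationMonoid
  Literature.NumberTheory.LFunctions Literature.NumberTheory.LFunctions.NumberField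
  Literature.NumberTheory.Sieve.CastilloEtAl2015 Literature.NumberTheory.Sieve.MitsuiPNT
  Literature.NumberTheory.Sieve.TypeTwoCoeff Literature.NumberTheory.Sieve.TypeTwoBlock
open scoped Classical

namespace Literature.NumberTheory.Sieve.SmoothPrimePowers

variable {K : Type*} [Field K] [NumberField K]

local notation "d" => Module.finrank ℚ K
local notation "rk" => Module.finrank ℝ (NumberField.Units.dirichletUnitTheorem.logSpace K)

/-! ## Prime powers as `(P, j)` -/

/-- A nonzero ideal with `Λ(𝔞) ≠ 0` is `P^j` with `P` its unique prime factor and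
`j = #(normalizedFactors 𝔞)`. [folklore] -/
theorem eq_pow_of_vonMangoldt_ne_zero {𝔞 : Ideal (𝓞 K)} (h𝔞 : 𝔞 ≠ ⊥) (hΛ : idealVonMangoldt 𝔞 ≠ 0) :
    ∃ P : Ideal (𝓞 K), Prime P ∧ (normalizedFactors 𝔞).toFinset = {P} ∧
      𝔞 = P ^ Multiset.card (normalizedFactors 𝔞) := by
  have hcard : (normalizedFactors 𝔞).toFinset.card = 1 := by
    by_contra h; exact hΛ (idealVonMangoldt_eq_zero h)
  obtain ⟨P, hP⟩ := Finset.card_eq_one.1 hcard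
  have hPmem : P ∈ normalizedFactors 𝔞 := by
    have : P ∈ (normalizedFactors 𝔞).toFinset := by rw [hP]; exact Finset.mem_singleton_self P
    exact Multiset.mem_toFinset.1 this
  have hall : ∀ Q ∈ normalizedFactors 𝔞, Q = P := fun Q hQ => by
    have : Q ∈ (normalizedFactors 𝔞).toFinset := Multiset.mem_toFinset.2 hQ
    rw [hP] at this; exact Finset.mem_singleton.1 this
  have hrep : normalizedFactors 𝔞 = Multiset.replicate (Multiset.card (normalizedFactors 𝔞)) P :=
    Multiset.eq_replicate.2 ⟨rfl, hall⟩
  refine ⟨P, prime_of_normalized_factor P hPmem, hP, ?_⟩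
  have := associated_iff_eq.1 (prod_normalizedFactors h𝔞)
  rw [hrep, Multiset.prod_replicate] at this
  exact this.symm

/-- **Higher prime powers up to `X` are few**:
`#{𝔞 : N𝔞 ≤ X, Λ(𝔞) ≠ 0, 𝔞 not prime} ≤ #idealsLE(√X) · (log₂⌊X⌋ + 1)`. [cite: Hinz1988, §2 (2.4)] -/
theorem card_higherPrimePowers_le (X : ℝ) :
    ((idealsLE K X).filter (fun 𝔞 => idealVonMangoldt 𝔞 ≠ 0 ∧ ¬ 𝔞.IsPrime)).card ≤
      (idealsLE K (Real.sqrt X)).card * (Nat.log 2 ⌊X⌋₊ + 1) := by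
  set S := (idealsLE K X).filter (fun 𝔞 => idealVonMangoldt 𝔞 ≠ 0 ∧ ¬ 𝔞.IsPrime) with hS
  set T := idealsLE K (Real.sqrt X) ×ˢ Finset.range (Nat.log 2 ⌊X⌋₊ + 1) with hT
  -- the data of each `𝔞 ∈ S`
  have hdata : ∀ 𝔞 ∈ S, ∃ P : Ideal (𝓞 K), Prime P ∧ (normalizedFactors 𝔞).toFinset = {P} ∧
      𝔞 = P ^ Multiset.card (normalizedFactors 𝔞) ∧ 2 ≤ Multiset.card (normalizedFactors 𝔞) ∧
      P ∈ idealsLE K (Real.sqrt X) ∧ Multiset.card (normalizedFactors 𝔞) < Nat.log 2 ⌊X⌋₊ + 1 := by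
    intro 𝔞 h𝔞
    rw [hS, Finset.mem_filter, mem_idealsLE] at h𝔞
    obtain ⟨⟨h0, hX⟩, hΛ, hnp⟩ := h𝔞
    obtain ⟨P, hP, hPF, heq⟩ := eq_pow_of_vonMangoldt_ne_zero h0 hΛ
    set j := Multiset.card (normalizedFactors 𝔞) with hj
    have hj1 : j ≠ 1 := by
      intro h1; rw [h1, pow_one] at heq; exact hnp (heq ▸ Ideal.isPrime_of_prime hP)
    have hj0 : j ≠ 0 := by
      intro h0'
      -- `j = 0` forces `(normalizedFactors 𝔞).toFinset = ∅`, contradicting `= {P}`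
      have : normalizedFactors 𝔞 = 0 := Multiset.card_eq_zero.1 (hj ▸ h0')
      rw [this] at hPF
      exact absurd hPF.symm (Finset.singleton_ne_empty P)
    have hj2 : 2 ≤ j := by omega
    have hPmax : P.IsMaximal := (Ideal.isPrime_of_prime hP).isMaximal hP.ne_zero
    have hNP2 : 2 ≤ Ideal.absNorm P := by
      have hne1 := Ideal.absNorm_eq_one_iff.not.2 hPmax.ne_top
      have h1 : 1 ≤ Ideal.absNorm P := Nat.one_le_iff_ne_zero.2 (by rw [Ne, Ideal.absNorm_eq_zero_iff]; exact hP.ne_zero)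
      omega
    have hN𝔞 : Ideal.absNorm 𝔞 = Ideal.absNorm P ^ j := by rw [heq, map_pow]
    -- `N P ≤ √X`
    have hPX : (Ideal.absNorm P : ℝ) ≤ Real.sqrt X := by
      have h2 : (Ideal.absNorm P : ℝ) ^ 2 ≤ Ideal.absNorm 𝔞 := by
        rw [hN𝔞, Nat.cast_pow]
        exact pow_le_pow_right₀ (by exact_mod_cast Nat.one_le_iff_ne_zero.2 (by omega)) hj2
      have hX0 : 0 ≤ X := le_trans (Nat.cast_nonneg _) hX
      rw [Real.le_sqrt (Nat.cast_nonneg _) hX0]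
      exact h2.trans hX
    -- `j ≤ log₂ N𝔞 ≤ log₂ ⌊X⌋`
    have hjlog : j < Nat.log 2 ⌊X⌋₊ + 1 := by
      have h2j : 2 ^ j ≤ Ideal.absNorm 𝔞 := by rw [hN𝔞]; exact Nat.pow_le_pow_left hNP2 j
      have hfl : Ideal.absNorm 𝔞 ≤ ⌊X⌋₊ := Nat.le_floor hX
      have : j ≤ Nat.log 2 ⌊X⌋₊ := Nat.le_log_of_pow_le one_lt_two (h2j.trans hfl)
      omega
    exact ⟨P, hP, hPF, heq, hj2, mem_idealsLE.2 ⟨hP.ne_zero, hPX⟩, hjlog⟩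
  -- the injection `𝔞 ↦ (P, j)`
  choose! Pof hPof using hdata
  have hinj : Set.InjOn (fun 𝔞 => (Pof 𝔞, Multiset.card (normalizedFactors 𝔞))) (S : Set (Ideal (𝓞 K))) := by
    intro 𝔞 h𝔞 𝔟 h𝔟 h
    rw [Finset.mem_coe] at h𝔞 h𝔟
    simp only [Prod.mk.injEq] at h
    obtain ⟨h1, h2⟩ := h
    rw [(hPof 𝔞 h𝔞).2.2.1, (hPof 𝔟 h𝔟).2.2.1, h1, h2]
  calc S.card = (S.image fun 𝔞 => (Pof 𝔞, Multiset.card (normalizedFactors 𝔞))).card :=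
        (Finset.card_image_of_injOn hinj).symm
    _ ≤ T.card := Finset.card_le_card fun p hp => by
        obtain ⟨𝔞, h𝔞, rfl⟩ := Finset.mem_image.1 hp
        rw [hT, Finset.mem_product, Finset.mem_range]
        exact ⟨(hPof 𝔞 h𝔞).2.2.2.2.1, (hPof 𝔞 h𝔞).2.2.2.2.2⟩
    _ = _ := by rw [hT, Finset.card_product, Finset.card_range]

/-! ## In the cube -/

/-- **Higher prime powers generated in the cube are few**: for `M ≥ 1`,
`#{α ∈ A₀(M) : Λ((α)) ≠ 0, (α) not prime} ≤ C_g (1+log M)^{r} #idealsLE(√(M^d)) (log₂⌊M^d⌋ + 1)`.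
[cite: Hinz1988, §2 (2.4)] -/
theorem card_cube_higherPrimePowers_le [IsTotallyReal K] {Cg : ℝ} (hCg0 : 0 ≤ Cg)
    (hCg : ∀ X : ℝ, 1 ≤ X → ∀ I : Ideal (𝓞 K),
      (Nat.card {α : 𝓞 K // α ∈ box₀ K X ∧ Ideal.span {α} = I} : ℝ) ≤ Cg * (1 + Real.log X) ^ rk)
    {M : ℝ} (hM : 1 ≤ M) :
    (((cubeF K M).filter (fun α => idealVonMangoldt (Ideal.span {α}) ≠ 0 ∧ ¬ (Ideal.span {α}).IsPrime)).card : ℝ) ≤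
      Cg * (1 + Real.log M) ^ rk * ((idealsLE K (Real.sqrt (M ^ d))).card * (Nat.log 2 ⌊M ^ d⌋₊ + 1)) := by
  set S := (cubeF K M).filter (fun α => idealVonMangoldt (Ideal.span {α}) ≠ 0 ∧ ¬ (Ideal.span {α}).IsPrime) with hS
  set f : Ideal (𝓞 K) → ℝ := fun 𝔞 => if idealVonMangoldt 𝔞 ≠ 0 ∧ ¬ 𝔞.IsPrime then 1 else 0 with hf
  have hf0 : ∀ 𝔞, 0 ≤ f 𝔞 := fun 𝔞 => by simp only [hf]; split_ifs <;> norm_num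
  have h1 : (S.card : ℝ) = ∑ α ∈ S, f (Ideal.span {α}) := by
    rw [Finset.card_eq_sum_ones, Nat.cast_sum]
    refine Finset.sum_congr rfl fun α hα => ?_
    simp only [hf, if_pos (Finset.mem_filter.1 hα).2, Nat.cast_one]
  have h2 := sum_box₀_le_mul_sum_ideals (K := K) hCg0 hCg hM S (fun α hα => mem_cubeF.1 (Finset.mem_filter.1 hα).1) f hf0
  have h3 : ∑ 𝔞 ∈ idealsLE K (M ^ d), f 𝔞 =
      ((idealsLE K (M ^ d)).filter (fun 𝔞 => idealVonMangoldt 𝔞 ≠ 0 ∧ ¬ 𝔞.IsPrime)).card := by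
    rw [Finset.card_eq_sum_ones, Nat.cast_sum, Finset.sum_filter]
    refine Finset.sum_congr rfl fun 𝔞 _ => ?_
    simp only [hf]; split_ifs <;> simp
  have h4 := card_higherPrimePowers_le (K := K) (M ^ d)
  rw [h1]
  refine h2.trans ?_
  rw [h3]
  refine mul_le_mul_of_nonneg_left (by exact_mod_cast h4) ?_
  have := Real.log_nonneg hM; positivity

end Literature.NumberTheory.Sieve.SmoothPrimePowers
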